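import Mathlib
import Summits.NavierStokesRegularity.NavierStokesRegularity.Theorems.ThreadingFluxHorizonTowerCubicIdentification
import HarnessLib

/-!
# Crux `PoloidalLiouville` (stmt-NavierStokesRegularity-1222, wall W1), crux idea «horizon-threading-tower» (ns-idea-15):
# the table cell `HorizonL2Octahedral` (degree 4) BY NAME — `𝔏₂[U_H] = 3456000·xyz(x²−y²)(x²−z²)(y²−z²)/r⁹`, `H = 5(x⁴+y⁴+z⁴) − 3r⁴`

Support file (Theorems-side tooling; seat ns-wall-eng-4 g2, cell ns-wall-extremal, W1 adjunct; `--supports stmt-NavierStokesRegularity-1222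
--as helper`).  The `l = 4` instance of the closed-form law `HorizonTower.horizonL2_horizonProfile_eq_det` (p672188; `κ₄ = 18`, `‖x‖⁹`) for the
octahedral quartic `H = 5Σyᵢ⁴ − 3‖y‖⁴` (isotropic: it escapes the far-field quadrupole law), with the kernel gradients of `H` and
`G = ‖∇H‖²` obtained from explicit line expansions (`∂ᵢH = 20yᵢ³ − 12‖y‖²yᵢ`):

* `Octahedral.poly_eq`, `contDiff_poly`, `poly_smul`, `poly_line`, `iteratedDeriv_two_quartic`, `laplacian_poly` — the quartic as a polynomial
  in the coordinates, smooth, 4-homogeneous, harmonic;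
* `Octahedral.inner_gradient_poly`, `gradient_poly_apply`, `gradNormSq_poly_eq`, `dH_line`, `hasDerivAt_sextic`, `inner_gradient_gradNormSq_poly` —
  `∇H` and `∇‖∇H‖²` in coordinates;
* ★ `HorizonTower.horizonL2Octahedral : HorizonL2Octahedral` — the TABLE CELL of `ThreadingFluxHorizonTowerDefs.lean` by name.

With `horizonL2Quadrupole` (p673251) and `horizonL2Tetrahedral` (p673002) the three non-zonal table cells are kernel theorems (`HorizonL2Zonal`
needs a local version of the law and stays engine-verified).  HONEST LABEL: an exact algebraic identity about the typed objects of one crux idea;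
information-grade for W1/W2 (movement 0); `PoloidalLiouville` (1222), `UnthreadedRigidity` (27585) and NS regularity remain OPEN and untouched.
[cite: MajdaBertozziCUP2002, §1.1 (vector identities)]
-/

-- the summit and its single problem share the name (D-0017 nested layout)
set_option linter.dupNamespace false

noncomputable section

open Set Function Filter Topology
open scoped Topology RealInnerProductSpace
open Literature.Analysis.FluidPDE

namespace Summit.NavierStokesRegularity.NavierStokesRegularity.Theorems.PoloidalLiouville.HorizonTower

namespace Octahedral

/-! ### The octahedral quartic as a polynomial in the coordinates -/

/-- `5Σyᵢ⁴ − 3‖y‖⁴ = 5Σyᵢ⁴ − 3(Σyᵢ²)²`. -/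
theorem poly_eq : (fun y : E3 => 5 * ((y 0) ^ 4 + (y 1) ^ 4 + (y 2) ^ 4) - 3 * ‖y‖ ^ 4)
    = fun y : E3 => 5 * ((y 0) ^ 4 + (y 1) ^ 4 + (y 2) ^ 4) - 3 * ((y 0) ^ 2 + (y 1) ^ 2 + (y 2) ^ 2) ^ 2 := by
  funext y
  have h : ‖y‖ ^ 4 = (‖y‖ ^ 2) ^ 2 := by ring
  rw [h, EuclideanSpace.norm_sq_eq, Fin.sum_univ_three, Real.norm_eq_abs, Real.norm_eq_abs, Real.norm_eq_abs,
    sq_abs, sq_abs, sq_abs]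

/-- The quartic is smooth. -/
theorem contDiff_poly : ContDiff ℝ (⊤ : ℕ∞)
    (fun y : E3 => 5 * ((y 0) ^ 4 + (y 1) ^ 4 + (y 2) ^ 4) - 3 * ((y 0) ^ 2 + (y 1) ^ 2 + (y 2) ^ 2) ^ 2) := by
  have hc : ∀ i : Fin 3, ContDiff ℝ (⊤ : ℕ∞) fun p : E3 => p i := fun i => (contDiff_euclidean.mp contDiff_id) i
  have h0 := hc 0
  have h1 := hc 1
  have h2 := hc 2
  fun_prop

/-- The quartic is homogeneous of degree four. -/
theorem poly_smul (c : ℝ) (y : E3) :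
    (fun y : E3 => 5 * ((y 0) ^ 4 + (y 1) ^ 4 + (y 2) ^ 4) - 3 * ((y 0) ^ 2 + (y 1) ^ 2 + (y 2) ^ 2) ^ 2) (c • y)
      = c ^ 4 * (fun y : E3 => 5 * ((y 0) ^ 4 + (y 1) ^ 4 + (y 2) ^ 4) - 3 * ((y 0) ^ 2 + (y 1) ^ 2 + (y 2) ^ 2) ^ 2) y := by
  simp only [PiLp.smul_apply, smul_eq_mul]
  ring

/-- The quartic along a line: an explicit quartic polynomial in `t`. -/
theorem poly_line (p v : E3) (t : ℝ) :
    (fun y : E3 => 5 * ((y 0) ^ 4 + (y 1) ^ 4 + (y 2) ^ 4) - 3 * ((y 0) ^ 2 + (y 1) ^ 2 + (y 2) ^ 2) ^ 2) (p + t • v)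
      = (5 * ((p 0) ^ 4 + (p 1) ^ 4 + (p 2) ^ 4) - 3 * ((p 0) ^ 2 + (p 1) ^ 2 + (p 2) ^ 2) ^ 2)
        + t * (v 0 * (20 * (p 0) ^ 3 - 12 * ((p 0) ^ 2 + (p 1) ^ 2 + (p 2) ^ 2) * p 0)
              + v 1 * (20 * (p 1) ^ 3 - 12 * ((p 0) ^ 2 + (p 1) ^ 2 + (p 2) ^ 2) * p 1)
              + v 2 * (20 * (p 2) ^ 3 - 12 * ((p 0) ^ 2 + (p 1) ^ 2 + (p 2) ^ 2) * p 2))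
        + t ^ 2 * (30 * ((p 0) ^ 2 * (v 0) ^ 2 + (p 1) ^ 2 * (v 1) ^ 2 + (p 2) ^ 2 * (v 2) ^ 2)
              - 12 * (p 0 * v 0 + p 1 * v 1 + p 2 * v 2) ^ 2
              - 6 * ((p 0) ^ 2 + (p 1) ^ 2 + (p 2) ^ 2) * ((v 0) ^ 2 + (v 1) ^ 2 + (v 2) ^ 2))
        + t ^ 3 * (20 * (p 0 * (v 0) ^ 3 + p 1 * (v 1) ^ 3 + p 2 * (v 2) ^ 3)
              - 12 * (p 0 * v 0 + p 1 * v 1 + p 2 * v 2) * ((v 0) ^ 2 + (v 1) ^ 2 + (v 2) ^ 2))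
        + t ^ 4 * (5 * ((v 0) ^ 4 + (v 1) ^ 4 + (v 2) ^ 4) - 3 * ((v 0) ^ 2 + (v 1) ^ 2 + (v 2) ^ 2) ^ 2) := by
  simp only [PiLp.add_apply, PiLp.smul_apply, smul_eq_mul]
  ring

/-- `(d/dt)²|₀ (A + tB + t²C + t³D + t⁴E) = 2C`. [folklore] -/
theorem iteratedDeriv_two_quartic (A B C D E : ℝ) :
    iteratedDeriv 2 (fun t : ℝ => A + t * B + t ^ 2 * C + t ^ 3 * D + t ^ 4 * E) 0 = 2 * C := by
  have hd : ∀ t : ℝ, HasDerivAt (fun t : ℝ => A + t * B + t ^ 2 * C + t ^ 3 * D + t ^ 4 * E)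
      (B + 2 * t * C + 3 * t ^ 2 * D + 4 * t ^ 3 * E) t := by
    intro t
    have h := ((((hasDerivAt_const t A).add ((hasDerivAt_id t).mul_const B)).add
      ((hasDerivAt_pow 2 t).mul_const C)).add ((hasDerivAt_pow 3 t).mul_const D)).add ((hasDerivAt_pow 4 t).mul_const E)
    exact h.congr_deriv (by norm_num)
  have h1 : deriv (fun t : ℝ => A + t * B + t ^ 2 * C + t ^ 3 * D + t ^ 4 * E)
      = fun t => B + 2 * t * C + 3 * t ^ 2 * D + 4 * t ^ 3 * E := funext fun t => (hd t).deriv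
  have hd2 : HasDerivAt (fun t : ℝ => B + 2 * t * C + 3 * t ^ 2 * D + 4 * t ^ 3 * E) (2 * C) 0 := by
    have h := (((hasDerivAt_const (0 : ℝ) B).add (((hasDerivAt_id (0 : ℝ)).const_mul 2).mul_const C)).add
      (((hasDerivAt_pow 2 (0 : ℝ)).const_mul 3).mul_const D)).add (((hasDerivAt_pow 3 (0 : ℝ)).const_mul 4).mul_const E)
    exact h.congr_deriv (by norm_num)
  rw [iteratedDeriv_succ, iteratedDeriv_one, h1, hd2.deriv]

/-- The quartic is harmonic (`Δ(5Σyᵢ⁴) = 60‖y‖² = Δ(3‖y‖⁴)`). -/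
theorem laplacian_poly (p : E3) :
    @Laplacian.laplacian (E3 → ℝ) (E3 → ℝ) _
      (fun y : E3 => 5 * ((y 0) ^ 4 + (y 1) ^ 4 + (y 2) ^ 4) - 3 * ((y 0) ^ 2 + (y 1) ^ 2 + (y 2) ^ 2) ^ 2) p = 0 := by
  have h2 : ContDiff ℝ 2 (fun y : E3 => 5 * ((y 0) ^ 4 + (y 1) ^ 4 + (y 2) ^ 4) - 3 * ((y 0) ^ 2 + (y 1) ^ 2 + (y 2) ^ 2) ^ 2) :=
    contDiff_poly.of_le (by norm_cast)
  rw [laplacian_eq_sum_iteratedDeriv_line h2]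
  simp only [poly_line, iteratedDeriv_two_quartic, Fin.sum_univ_three]
  simp
  ring

/-! ### The gradient of the quartic and of `G = ‖∇H‖²` in coordinates -/

/-- `⟪∇H(p), v⟫ = Σᵢ vᵢ (20pᵢ³ − 12‖p‖²pᵢ)`. -/
theorem inner_gradient_poly (p v : E3) :
    ⟪gradient (fun y : E3 => 5 * ((y 0) ^ 4 + (y 1) ^ 4 + (y 2) ^ 4) - 3 * ((y 0) ^ 2 + (y 1) ^ 2 + (y 2) ^ 2) ^ 2) p, v⟫
      = v 0 * (20 * (p 0) ^ 3 - 12 * ((p 0) ^ 2 + (p 1) ^ 2 + (p 2) ^ 2) * p 0)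
        + v 1 * (20 * (p 1) ^ 3 - 12 * ((p 0) ^ 2 + (p 1) ^ 2 + (p 2) ^ 2) * p 1)
        + v 2 * (20 * (p 2) ^ 3 - 12 * ((p 0) ^ 2 + (p 1) ^ 2 + (p 2) ^ 2) * p 2) := by
  set F : E3 → ℝ := fun y : E3 => 5 * ((y 0) ^ 4 + (y 1) ^ 4 + (y 2) ^ 4) - 3 * ((y 0) ^ 2 + (y 1) ^ 2 + (y 2) ^ 2) ^ 2 with hF
  rw [Literature.Analysis.FluidPDE.inner_gradient_left]
  have hderiv : HasDerivAt (fun t : ℝ => F (p + t • v))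
      (v 0 * (20 * (p 0) ^ 3 - 12 * ((p 0) ^ 2 + (p 1) ^ 2 + (p 2) ^ 2) * p 0)
        + v 1 * (20 * (p 1) ^ 3 - 12 * ((p 0) ^ 2 + (p 1) ^ 2 + (p 2) ^ 2) * p 1)
        + v 2 * (20 * (p 2) ^ 3 - 12 * ((p 0) ^ 2 + (p 1) ^ 2 + (p 2) ^ 2) * p 2)) 0 := by
    have hfun : (fun t : ℝ => F (p + t • v)) = _ := funext fun t => poly_line p v t
    rw [hfun]
    exact CubicCert.hasDerivAt_quartic _ _ _ _ _
  have hdiff : Differentiable ℝ F := (contDiff_poly.differentiable (by simp))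
  have hl : HasDerivAt (fun t : ℝ => p + t • v) v 0 := by
    simpa using ((hasDerivAt_id (0 : ℝ)).smul_const v).const_add p
  have hchain : HasDerivAt (F ∘ fun t : ℝ => p + t • v) (fderiv ℝ F p v) 0 := by
    have h := (hdiff (p + (0 : ℝ) • v)).hasFDerivAt.comp_hasDerivAt (0 : ℝ) hl
    rw [zero_smul, add_zero] at h
    exact h
  exact hchain.unique hderiv

/-- The components of `∇H(p)`: `20pᵢ³ − 12‖p‖²pᵢ`. -/
theorem gradient_poly_apply (p : E3) (i : Fin 3) :
    gradient (fun y : E3 => 5 * ((y 0) ^ 4 + (y 1) ^ 4 + (y 2) ^ 4) - 3 * ((y 0) ^ 2 + (y 1) ^ 2 + (y 2) ^ 2) ^ 2) p i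
      = 20 * (p i) ^ 3 - 12 * ((p 0) ^ 2 + (p 1) ^ 2 + (p 2) ^ 2) * p i := by
  have h : gradient (fun y : E3 => 5 * ((y 0) ^ 4 + (y 1) ^ 4 + (y 2) ^ 4) - 3 * ((y 0) ^ 2 + (y 1) ^ 2 + (y 2) ^ 2) ^ 2) p i
      = ⟪gradient (fun y : E3 => 5 * ((y 0) ^ 4 + (y 1) ^ 4 + (y 2) ^ 4) - 3 * ((y 0) ^ 2 + (y 1) ^ 2 + (y 2) ^ 2) ^ 2) p,
          EuclideanSpace.single i (1 : ℝ)⟫ := by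
    rw [EuclideanSpace.inner_single_right]; simp
  rw [h, inner_gradient_poly]
  fin_cases i <;> simp

/-- `G = ‖∇H‖²` as an explicit polynomial in the coordinates. -/
theorem gradNormSq_poly_eq :
    (fun w : E3 => ‖gradient (fun y : E3 => 5 * ((y 0) ^ 4 + (y 1) ^ 4 + (y 2) ^ 4) - 3 * ((y 0) ^ 2 + (y 1) ^ 2 + (y 2) ^ 2) ^ 2) w‖ ^ 2)
      = fun w : E3 => (20 * (w 0) ^ 3 - 12 * ((w 0) ^ 2 + (w 1) ^ 2 + (w 2) ^ 2) * w 0) ^ 2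
          + (20 * (w 1) ^ 3 - 12 * ((w 0) ^ 2 + (w 1) ^ 2 + (w 2) ^ 2) * w 1) ^ 2
          + (20 * (w 2) ^ 3 - 12 * ((w 0) ^ 2 + (w 1) ^ 2 + (w 2) ^ 2) * w 2) ^ 2 := by
  funext w
  rw [EuclideanSpace.norm_sq_eq, Fin.sum_univ_three, Real.norm_eq_abs, Real.norm_eq_abs, Real.norm_eq_abs,
    sq_abs, sq_abs, sq_abs, gradient_poly_apply, gradient_poly_apply, gradient_poly_apply]

/-- A partial derivative `20yᵢ³ − 12‖y‖²yᵢ` along a line: an explicit cubic in `t`. -/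
theorem dH_line (p v : E3) (i : Fin 3) (t : ℝ) :
    20 * ((p + t • v) i) ^ 3 - 12 * (((p + t • v) 0) ^ 2 + ((p + t • v) 1) ^ 2 + ((p + t • v) 2) ^ 2) * (p + t • v) i
      = (20 * (p i) ^ 3 - 12 * ((p 0) ^ 2 + (p 1) ^ 2 + (p 2) ^ 2) * p i)
        + t * (v i * (60 * (p i) ^ 2 - 12 * ((p 0) ^ 2 + (p 1) ^ 2 + (p 2) ^ 2)) - 24 * p i * (p 0 * v 0 + p 1 * v 1 + p 2 * v 2))
        + t ^ 2 * (60 * p i * (v i) ^ 2 - 12 * ((v 0) ^ 2 + (v 1) ^ 2 + (v 2) ^ 2) * p i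
            - 24 * (p 0 * v 0 + p 1 * v 1 + p 2 * v 2) * v i)
        + t ^ 3 * (20 * (v i) ^ 3 - 12 * ((v 0) ^ 2 + (v 1) ^ 2 + (v 2) ^ 2) * v i) := by
  simp only [PiLp.add_apply, PiLp.smul_apply, smul_eq_mul]
  ring

/-- `(d/dt)|₀` of an explicit sextic is its linear coefficient. [folklore] -/
theorem hasDerivAt_sextic (K₀ K₁ K₂ K₃ K₄ K₅ K₆ : ℝ) :
    HasDerivAt (fun t : ℝ => K₀ + t * K₁ + t ^ 2 * K₂ + t ^ 3 * K₃ + t ^ 4 * K₄ + t ^ 5 * K₅ + t ^ 6 * K₆) K₁ 0 := by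
  have h1 : HasDerivAt (fun t : ℝ => t * K₁) K₁ 0 := by simpa using (hasDerivAt_id (0 : ℝ)).mul_const K₁
  have h2 : HasDerivAt (fun t : ℝ => t ^ 2 * K₂) 0 0 := by simpa using (hasDerivAt_pow 2 (0 : ℝ)).mul_const K₂
  have h3 : HasDerivAt (fun t : ℝ => t ^ 3 * K₃) 0 0 := by simpa using (hasDerivAt_pow 3 (0 : ℝ)).mul_const K₃
  have h4 : HasDerivAt (fun t : ℝ => t ^ 4 * K₄) 0 0 := by simpa using (hasDerivAt_pow 4 (0 : ℝ)).mul_const K₄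
  have h5 : HasDerivAt (fun t : ℝ => t ^ 5 * K₅) 0 0 := by simpa using (hasDerivAt_pow 5 (0 : ℝ)).mul_const K₅
  have h6 : HasDerivAt (fun t : ℝ => t ^ 6 * K₆) 0 0 := by simpa using (hasDerivAt_pow 6 (0 : ℝ)).mul_const K₆
  have h := ((((((hasDerivAt_const (0 : ℝ) K₀).add h1).add h2).add h3).add h4).add h5).add h6
  simp only [zero_add, add_zero] at h
  exact h

/-- **`⟪∇G(p), v⟫ = 2 Σᵢ ∂ᵢH(p) · (Hess H(p) v)ᵢ`** for the octahedral quartic, `G = ‖∇H‖²`, with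
`(Hess H(p) v)ᵢ = vᵢ(60pᵢ² − 12‖p‖²) − 24 pᵢ ⟪p, v⟫`. -/
theorem inner_gradient_gradNormSq_poly (p v : E3) :
    ⟪gradient (fun w : E3 => ‖gradient (fun y : E3 => 5 * ((y 0) ^ 4 + (y 1) ^ 4 + (y 2) ^ 4)
        - 3 * ((y 0) ^ 2 + (y 1) ^ 2 + (y 2) ^ 2) ^ 2) w‖ ^ 2) p, v⟫
      = 2 * ((20 * (p 0) ^ 3 - 12 * ((p 0) ^ 2 + (p 1) ^ 2 + (p 2) ^ 2) * p 0)
              * (v 0 * (60 * (p 0) ^ 2 - 12 * ((p 0) ^ 2 + (p 1) ^ 2 + (p 2) ^ 2)) - 24 * p 0 * (p 0 * v 0 + p 1 * v 1 + p 2 * v 2))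
            + (20 * (p 1) ^ 3 - 12 * ((p 0) ^ 2 + (p 1) ^ 2 + (p 2) ^ 2) * p 1)
              * (v 1 * (60 * (p 1) ^ 2 - 12 * ((p 0) ^ 2 + (p 1) ^ 2 + (p 2) ^ 2)) - 24 * p 1 * (p 0 * v 0 + p 1 * v 1 + p 2 * v 2))
            + (20 * (p 2) ^ 3 - 12 * ((p 0) ^ 2 + (p 1) ^ 2 + (p 2) ^ 2) * p 2)
              * (v 2 * (60 * (p 2) ^ 2 - 12 * ((p 0) ^ 2 + (p 1) ^ 2 + (p 2) ^ 2)) - 24 * p 2 * (p 0 * v 0 + p 1 * v 1 + p 2 * v 2))) := by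
  rw [gradNormSq_poly_eq, Literature.Analysis.FluidPDE.inner_gradient_left]
  set Gp : E3 → ℝ := fun w : E3 => (20 * (w 0) ^ 3 - 12 * ((w 0) ^ 2 + (w 1) ^ 2 + (w 2) ^ 2) * w 0) ^ 2
      + (20 * (w 1) ^ 3 - 12 * ((w 0) ^ 2 + (w 1) ^ 2 + (w 2) ^ 2) * w 1) ^ 2
      + (20 * (w 2) ^ 3 - 12 * ((w 0) ^ 2 + (w 1) ^ 2 + (w 2) ^ 2) * w 2) ^ 2 with hGp
  -- line data `∂ᵢH(p + t v) = Aᵢ + t Bᵢ + t² Cᵢ + t³ Dᵢ`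
  set A : Fin 3 → ℝ := fun i => 20 * (p i) ^ 3 - 12 * ((p 0) ^ 2 + (p 1) ^ 2 + (p 2) ^ 2) * p i with hA
  set B : Fin 3 → ℝ := fun i =>
    v i * (60 * (p i) ^ 2 - 12 * ((p 0) ^ 2 + (p 1) ^ 2 + (p 2) ^ 2)) - 24 * p i * (p 0 * v 0 + p 1 * v 1 + p 2 * v 2) with hB
  set C : Fin 3 → ℝ := fun i => 60 * p i * (v i) ^ 2 - 12 * ((v 0) ^ 2 + (v 1) ^ 2 + (v 2) ^ 2) * p i
    - 24 * (p 0 * v 0 + p 1 * v 1 + p 2 * v 2) * v i with hC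
  set D : Fin 3 → ℝ := fun i => 20 * (v i) ^ 3 - 12 * ((v 0) ^ 2 + (v 1) ^ 2 + (v 2) ^ 2) * v i with hD
  have hline : (fun t : ℝ => Gp (p + t • v)) = fun t : ℝ =>
      (A 0 ^ 2 + A 1 ^ 2 + A 2 ^ 2) + t * (2 * (A 0 * B 0 + A 1 * B 1 + A 2 * B 2))
        + t ^ 2 * (B 0 ^ 2 + B 1 ^ 2 + B 2 ^ 2 + 2 * (A 0 * C 0 + A 1 * C 1 + A 2 * C 2))
        + t ^ 3 * (2 * (A 0 * D 0 + A 1 * D 1 + A 2 * D 2) + 2 * (B 0 * C 0 + B 1 * C 1 + B 2 * C 2))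
        + t ^ 4 * (C 0 ^ 2 + C 1 ^ 2 + C 2 ^ 2 + 2 * (B 0 * D 0 + B 1 * D 1 + B 2 * D 2))
        + t ^ 5 * (2 * (C 0 * D 0 + C 1 * D 1 + C 2 * D 2)) + t ^ 6 * (D 0 ^ 2 + D 1 ^ 2 + D 2 ^ 2) := by
    funext t
    simp only [hGp]
    rw [dH_line p v 0, dH_line p v 1, dH_line p v 2]
    simp only [hA, hB, hC, hD]
    ring
  have hderiv : HasDerivAt (fun t : ℝ => Gp (p + t • v)) (2 * (A 0 * B 0 + A 1 * B 1 + A 2 * B 2)) 0 := by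
    rw [hline]
    exact hasDerivAt_sextic _ _ _ _ _ _ _
  have hdiff : Differentiable ℝ Gp := by
    have hc : ∀ i : Fin 3, Differentiable ℝ fun w : E3 => w i := fun i => differentiable_euclidean.mp differentiable_id i
    have h0 := hc 0
    have h1 := hc 1
    have h2 := hc 2
    simp only [hGp]
    fun_prop
  have hl : HasDerivAt (fun t : ℝ => p + t • v) v 0 := by
    simpa using ((hasDerivAt_id (0 : ℝ)).smul_const v).const_add p
  have hchain : HasDerivAt (Gp ∘ fun t : ℝ => p + t • v) (fderiv ℝ Gp p v) 0 := by
    have h := (hdiff (p + (0 : ℝ) • v)).hasFDerivAt.comp_hasDerivAt (0 : ℝ) hl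
    rw [zero_smul, add_zero] at h
    exact h
  have := hchain.unique hderiv
  rw [this]

end Octahedral

/-! ### The table cell -/

/-- ★ **The table cell `HorizonL2Octahedral` BY NAME**: for the octahedral quartic `H = 5(x⁴+y⁴+z⁴) − 3r⁴`,
`𝔏₂[U_H](x) = 3456000 · xyz (x²−y²)(x²−z²)(y²−z²)/‖x‖⁹` off the origin (the product of the nine mirror planes of `O_h`): the horizon law
threads the isotropic quartic at order two.  The `l = 4` instance of `horizonL2_horizonProfile_eq_det` (`κ₄ = 18`). -/
theorem horizonL2Octahedral : HorizonL2Octahedral := by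
  intro x hx
  rw [Octahedral.poly_eq, horizonL2_horizonProfile_eq_det (l := 4) (by norm_num) Octahedral.contDiff_poly
    (fun c y => Octahedral.poly_smul c y) Octahedral.laplacian_poly hx]
  set g : E3 := gradient (fun w : E3 => ‖gradient (fun y : E3 => 5 * ((y 0) ^ 4 + (y 1) ^ 4 + (y 2) ^ 4)
    - 3 * ((y 0) ^ 2 + (y 1) ^ 2 + (y 2) ^ 2) ^ 2) w‖ ^ 2) x with hg
  have hg0 : g 0 = ⟪g, EuclideanSpace.single 0 (1 : ℝ)⟫ := by rw [EuclideanSpace.inner_single_right]; simp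
  have hg1 : g 1 = ⟪g, EuclideanSpace.single 1 (1 : ℝ)⟫ := by rw [EuclideanSpace.inner_single_right]; simp
  have hg2 : g 2 = ⟪g, EuclideanSpace.single 2 (1 : ℝ)⟫ := by rw [EuclideanSpace.inner_single_right]; simp
  rw [hg, Octahedral.inner_gradient_gradNormSq_poly] at hg0 hg1 hg2
  simp at hg0 hg1 hg2
  obtain ⟨c0, c1, c2⟩ := cross_fin3 g x
  have hr : ‖x‖ ^ 9 ≠ 0 := pow_ne_zero _ (norm_ne_zero_iff.2 hx)
  have h9 : ‖x‖ ^ (3 * (4 - 1)) = ‖x‖ ^ 9 := by norm_num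
  rw [h9, div_eq_div_iff hr hr, Octahedral.inner_gradient_poly, c0, c1, c2, hg0, hg1, hg2]
  push_cast
  ring

end Summit.NavierStokesRegularity.NavierStokesRegularity.Theorems.PoloidalLiouville.HorizonTower

end
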